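import Summits.NavierStokesRegularity.NavierStokesRegularity.Theorems.SelfMixingDichotomyCoherentScaleExclusionSelfSimilarSwirlPointwise
import HarnessLib

/-!
# Crux `SelfMixingDichotomy.SequentialTypeIExclusion` (stmt-NavierStokesRegularity-1424), line
  `registered`, lead c6 (pulsating witness package): stub W2 `pulse_energy`

Lands `--supports stmt-NavierStokesRegularity-1424` the registered stub `pulse_energy` of the lead's
pulsating kinematic witness

  `u t x = (a t · (1 − t)⁻¹ · expNegInvGlue (4 − ‖x‖²/(1 − t))) • (−x₁, x₀, 0)`   (`t < 1`; `0` after):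

the uniform ENERGY bound. If `0 ≤ a t` and `(a t)² √(1 − t) ≤ 1` before `t = 1`, then every slice from
time `0` on is in `L²(ℝ³)` with `∫ ‖u t x‖² ≤ 32 |B₁|` (`|B₁| = (volume (ball 0 1)).toReal`).

At a fixed `t < 1` the slice is the self-similar swirl slice of the sibling crux S2
(`…CoherentScaleExclusionSelfSimilarSwirlPointwise`) with amplitude `A := a t` and `s := 1 − t`; we
re-prove S2's `selfSimilarSwirl_pointwise_energy_slice` with the SHARP constant
`∫ ‖slice‖² ≤ 32 A² √s |B₁|` (support in `closedBall 0 (2 √s)`, `‖slice‖² ≤ 4 A²/s` there,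
`|B(0, 2 √s)| = 8 s √s |B₁|`), and conclude with `A² √s ≤ 1`. For `t ≥ 1` the slice is `0`.
-/

noncomputable section

open MeasureTheory Set Metric
open scoped ENNReal ContDiff

-- `Summit = Problem` for this summit; the tree lakefile sets `weak.linter.dupNamespace = false`.
set_option linter.dupNamespace false

namespace Summit.NavierStokesRegularity.NavierStokesRegularity.Theorems.SequentialTypeIExclusion.Registered

/-- SHARP ENERGY of a slice: for `0 < s` and `A ≥ 0` the slice
`(A s⁻¹ · expNegInvGlue (4 - ‖x‖²/s)) • J x` is in `L²(ℝ³)` and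
`∫ ‖slice‖² ≤ 32 A² √s · (volume (ball 0 1)).toReal` (support in `closedBall 0 (2 √s)`,
`‖slice‖² ≤ 4 A²/s`, `volume (ball 0 R) = R³ · volume (ball 0 1)`, `(4 A²/s) · 8 s √s = 32 A² √s`). -/
theorem pulse_energy_slice {A s : ℝ} (hA : 0 ≤ A) (hs : 0 < s) :
    MemLp (fun x : EuclideanSpace ℝ (Fin 3) =>
      (A * s⁻¹ * expNegInvGlue (4 - ‖x‖ ^ 2 / s)) •
        (WithLp.toLp 2 ![-(x 1), x 0, 0] : EuclideanSpace ℝ (Fin 3))) 2 volume ∧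
    ∫ x : EuclideanSpace ℝ (Fin 3), ‖(A * s⁻¹ * expNegInvGlue (4 - ‖x‖ ^ 2 / s)) •
        (WithLp.toLp 2 ![-(x 1), x 0, 0] : EuclideanSpace ℝ (Fin 3))‖ ^ 2
      ≤ 32 * A ^ 2 * Real.sqrt s * (volume (ball (0 : EuclideanSpace ℝ (Fin 3)) 1)).toReal := by
  -- adapted from `selfSimilarSwirl_pointwise_energy_slice` (S2), keeping the factor `√s`
  set f : EuclideanSpace ℝ (Fin 3) → EuclideanSpace ℝ (Fin 3) := fun x =>
    (A * s⁻¹ * expNegInvGlue (4 - ‖x‖ ^ 2 / s)) •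
      (WithLp.toLp 2 ![-(x 1), x 0, 0] : EuclideanSpace ℝ (Fin 3)) with hf
  set R : ℝ := 2 * Real.sqrt s with hR
  have hR0 : 0 ≤ R := by positivity
  have hcont : Continuous f := kinWitness_pointwise_continuous_slice _ _
  have hzero : ∀ x, R ≤ ‖x‖ → f x = 0 := fun x hx =>
    selfSimilarSwirl_pointwise_slice_eq_zero A hs hx
  have hsupp : Function.support f ⊆ closedBall 0 R := by
    intro x hx
    rw [Function.mem_support] at hx
    rw [mem_closedBall, dist_zero_right]
    by_contra h
    exact hx (hzero x (not_le.mp h).le)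
  have hcs : HasCompactSupport f :=
    HasCompactSupport.of_support_subset_isCompact (isCompact_closedBall 0 R) hsupp
  refine ⟨hcont.memLp_of_hasCompactSupport hcs, ?_⟩
  have hbound : ∀ x, ‖f x‖ ^ 2 ≤ 4 * A ^ 2 / s := by
    intro x
    have h := selfSimilarSwirl_pointwise_sqrt_mul_norm_slice_le hA hs x
    have h0 : 0 ≤ Real.sqrt s * ‖f x‖ := by positivity
    have h2 : (Real.sqrt s * ‖f x‖) ^ 2 ≤ (2 * A) ^ 2 := pow_le_pow_left₀ h0 h 2
    rw [mul_pow, Real.sq_sqrt hs.le] at h2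
    rw [le_div_iff₀ hs]
    linarith
  have hvol : (volume (ball (0 : EuclideanSpace ℝ (Fin 3)) R)).toReal =
      R ^ 3 * (volume (ball (0 : EuclideanSpace ℝ (Fin 3)) 1)).toReal := by
    rw [Measure.addHaar_ball volume 0 hR0, finrank_euclideanSpace_fin, ENNReal.toReal_mul,
      ENNReal.toReal_ofReal (by positivity)]
  have hR3 : R ^ 3 = 8 * (Real.sqrt s * s) := by
    have h3 : Real.sqrt s ^ 3 = Real.sqrt s * Real.sqrt s ^ 2 := by ring
    rw [hR, mul_pow, h3, Real.sq_sqrt hs.le]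
    norm_num
  calc ∫ x, ‖f x‖ ^ 2 = ∫ x in ball (0 : EuclideanSpace ℝ (Fin 3)) R, ‖f x‖ ^ 2 := by
        symm
        apply setIntegral_eq_integral_of_forall_compl_eq_zero
        intro x hx
        rw [mem_ball_zero_iff, not_lt] at hx
        rw [hzero x hx, norm_zero, zero_pow two_ne_zero]
    _ ≤ ‖∫ x in ball (0 : EuclideanSpace ℝ (Fin 3)) R, ‖f x‖ ^ 2‖ := Real.le_norm_self _
    _ ≤ 4 * A ^ 2 / s * volume.real (ball (0 : EuclideanSpace ℝ (Fin 3)) R) :=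
        norm_setIntegral_le_of_norm_le_const measure_ball_lt_top fun x _ => by
          rw [Real.norm_eq_abs, abs_of_nonneg (by positivity)]
          exact hbound x
    _ = 32 * A ^ 2 * Real.sqrt s * (volume (ball (0 : EuclideanSpace ℝ (Fin 3)) 1)).toReal := by
        rw [measureReal_def, hvol, hR3, div_mul_eq_mul_div, div_eq_iff hs.ne']
        ring

/-- **W2 — stub `pulse_energy`** (crux stmt-NavierStokesRegularity-1424, line `registered`, lead c6):
energy of the pulsating eddy. If `0 ≤ a t` and `(a t)² √(1 − t) ≤ 1` before `t = 1`, every slice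
from time `0` on is in `L²` with `∫ ‖u t x‖² ≤ 32 |B₁|` (support in `B̄(0, 2√(1−t))`,
`‖u‖² ≤ 4 (a t)²/(1 − t)` there, `|B(0, 2√(1−t))| = 8 (1−t)^{3/2} |B₁|`; the slice is `0` for
`t ≥ 1`). -/
theorem pulse_energy :
    ∀ a : ℝ → ℝ, (∀ t : ℝ, t < 1 → 0 ≤ a t) → (∀ t : ℝ, t < 1 → a t ^ 2 * Real.sqrt (1 - t) ≤ 1) →
      ∀ t : ℝ, 0 ≤ t →
        MeasureTheory.MemLp ((fun (t : ℝ) (x : EuclideanSpace ℝ (Fin 3)) => if t < 1 then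
          (a t * (1 - t)⁻¹ * expNegInvGlue (4 - ‖x‖ ^ 2 / (1 - t))) •
            (WithLp.toLp 2 ![-(x 1), x 0, 0] : EuclideanSpace ℝ (Fin 3)) else 0) t) 2 MeasureTheory.volume ∧
        ∫ x, ‖(fun (t : ℝ) (x : EuclideanSpace ℝ (Fin 3)) => if t < 1 then
          (a t * (1 - t)⁻¹ * expNegInvGlue (4 - ‖x‖ ^ 2 / (1 - t))) •
            (WithLp.toLp 2 ![-(x 1), x 0, 0] : EuclideanSpace ℝ (Fin 3)) else 0) t x‖ ^ 2 ≤
          32 * (MeasureTheory.volume (Metric.ball (0 : EuclideanSpace ℝ (Fin 3)) 1)).toReal := by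
  intro a ha hsq t _
  have hV : 0 ≤ (volume (ball (0 : EuclideanSpace ℝ (Fin 3)) 1)).toReal := ENNReal.toReal_nonneg
  by_cases ht : t < 1
  · simp only [if_pos ht]
    have hs : 0 < 1 - t := sub_pos.mpr ht
    obtain ⟨hmem, hint⟩ := pulse_energy_slice (ha t ht) hs
    refine ⟨hmem, hint.trans ?_⟩
    have h1 : a t ^ 2 * Real.sqrt (1 - t) ≤ 1 := hsq t ht
    calc 32 * a t ^ 2 * Real.sqrt (1 - t) * (volume (ball (0 : EuclideanSpace ℝ (Fin 3)) 1)).toReal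
        = 32 * (a t ^ 2 * Real.sqrt (1 - t)) *
            (volume (ball (0 : EuclideanSpace ℝ (Fin 3)) 1)).toReal := by ring
      _ ≤ 32 * 1 * (volume (ball (0 : EuclideanSpace ℝ (Fin 3)) 1)).toReal := by gcongr
      _ = 32 * (volume (ball (0 : EuclideanSpace ℝ (Fin 3)) 1)).toReal := by ring
  · simp only [if_neg ht, norm_zero, ne_eq, OfNat.ofNat_ne_zero, not_false_eq_true, zero_pow,
      integral_zero]
    exact ⟨MemLp.zero', by positivity⟩

end Summit.NavierStokesRegularity.NavierStokesRegularity.Theorems.SequentialTypeIExclusion.Registered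

end
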